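import Summits.CriticalPhenomena.SAWScalingLimit.Theorems.SAWDevelopingMapHexConjectureWindowRatioUniform
import Summits.CriticalPhenomena.SAWScalingLimit.Theorems.SAWDevelopingMapHexConjectureWindowBlockSum
import HarnessLib

/-!
# Crux `HexConjecture` (stmt-CriticalPhenomena-0808), line `root-locality-replaces-loewner`:
the window inequality of the bootstrap from the ARCH ASPECT BOUND — the floor-ratio limit supplies the window gain

Landing target:
`Summits/CriticalPhenomena/SAWScalingLimit/Theorems/SAWDevelopingMapHexConjectureWindowIneqOfAspectBound.lean`
(`--supports stmt-CriticalPhenomena-0808`; lead continuation prover-line-stmt-CriticalPhenomena-0808-c6-0).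

The lower bound of the re-plumbed bootstrap (`windowLowerBound`, p123193; `windowMaximiser_of_windowIneq`,
p125107) needs, eventually along `δ → 0⁺`, the WINDOW INEQUALITY
`Σ_{d ∈ [θ₁R, θ₀R]} Far^R_{Λδ}(a δ → t_d) ≤ η Σ_{d ∈ [θ₁R, θ₀R]} Z_{Λδ}(a δ → t_d)`, `R = ρ₁/(2δ)`.
Seat c5 took it from the window-averaged arch locality WAL (an `η`-statement).  Here it is derived from the
single-domain floor-ratio transport (hypothesis `hG`: `Z_{Λδ}(a δ, e δ)/Z_{Λδ}(a δ, b δ) → G(t)` along every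
admissible floor family `e δ → a + t`) with a profile `G ≥ κ t^{-5/4}` (simple pole of the half-plane map at
the root, boundary exponent `5/8`: `2 · 5/8 = 5/4 > 1`), and the `η`-FREE **arch aspect bound** (AAB):
`Σ_{d ∈ [θ₁R, θaR]} Far^R_Λ(s_x → t_d) ≤ C Σ_{d ∈ [θaR, θbR]} Z_B(s_x → t_d)` with ONE constant `C` for all
`θ₁ < θa`.  Proof (`windowIneq_of_aspectBound`): by `ratio_uniform_window` the ratios `Z_{Λδ}(a δ, t_d)/Z_{Λδ}(a δ, b δ)`
are within `ε` of `G(δ d)` uniformly over compact windows; on the reference window `[θa ρ₂, θb ρ₂]` this bounds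
the right-hand side of AAB by `(θb ρ₂ (G_max + 2)/δ) · Z(a, b)`; on the window `[θ₁ρ₂, θ₀ρ₂]` it bounds the
window mass BELOW by `Z(a,b) Σ_d (κ (δ d)^{-5/4} − ε)`, and the single dyadic block `[θ₁ρ₂/δ, 2θ₁ρ₂/δ]` already
carries `M/δ` for any prescribed `M` once `θ₁` is small (`window_block_sum_ge`): the window gain is UNBOUNDED as
`θ₁ → 0` because `t^{-5/4}` is not integrable at `0`.  Choosing `M = C · θbρ₂(G_max+2)/η + 1` gives the window
inequality with the prescribed `η`.
Sources: LawlerSchrammWerner2004SAW (§3.4, Prop. 2), DuminilCopinSmirnov2012 (Lemma 2).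
-/

noncomputable section

open scoped BigOperators Topology NNReal ENNReal Classical
open Filter Set MeasureTheory Metric
open Literature.Probability.LatticeModels (HexVertex hexGraph hexCenter Site)
open Literature.Probability.RandomPlanarGeometry
open Literature.Probability.RandomPlanarGeometry.SAW
open UpperHalfPlane (upperHalfPlaneSet)

namespace Summit.CriticalPhenomena.SAWScalingLimit.Theorems.HexConjecture.RootLocality

open Summit.CriticalPhenomena.SAWScalingLimit.Theorems.ObservableToSLE.FloorRatio


/-! ### Window points are admissible -/

/-- **Admissibility of a lattice window point.**  For a finite `Λ` whose vertices in the rigid ball are exactly the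
rows `≥ m`, a root cell `x` of row `m` with `(x, 0) ∈ Λ` and the vertex below it outside `Λ`, and an offset
`0 < d ≤ R` such that the lattice half-box of radius `R + 1/2` around `mid s_x` maps into the rigid ball: the inner
endpoint of the floor mid-edge `t_d = s_{x + d e₀}` lies in `Λ`, `t_d` is a boundary mid-edge of `Λ`, and there
is a walk `s_x → t_d` in `Λ`. [folklore] -/
theorem windowPoint_admissible {Λ : Finset HexVertex} {m : ℤ} {x : Site 2} {a₀ : ℂ} {ρ δ R : ℝ}
    (hrows : ∀ v : HexVertex, (δ : ℂ) * hexCenter v ∈ ball a₀ ρ → (v ∈ Λ ↔ m ≤ v.1 1))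
    (hball : ∀ v : HexVertex, dist (hexCenter v) (hexMidpoint s((x - Pi.single 1 1, 1), (x, 0))) ≤ R + 1 / 2 →
      (δ : ℂ) * hexCenter v ∈ ball a₀ ρ)
    (hx1 : x 1 = m) (hrowsΛ : ∀ v ∈ Λ, x 1 ≤ v.1 1) (hx0 : (x, (0 : Fin 2)) ∈ Λ)
    (hxd : (x - Pi.single 1 1, (1 : Fin 2)) ∉ Λ)
    (hconn : (hexGraph.induce ((Λ : Finset HexVertex) : Set HexVertex)).Preconnected)
    {d : ℤ} (hd0 : 0 < d) (hdR : (d : ℝ) ≤ R) :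
    (x + Pi.single 0 d, (0 : Fin 2)) ∈ Λ ∧
      s((x + Pi.single 0 d - Pi.single 1 1, 1), (x + Pi.single 0 d, 0)) ∈ hexDomainBoundary Λ ∧
      Nonempty (HexMidEdgeSAW Λ s((x - Pi.single 1 1, 1), (x, 0))
        s((x + Pi.single 0 d - Pi.single 1 1, 1), (x + Pi.single 0 d, 0))) := by
  have hdpos : (0 : ℝ) < d := by exact_mod_cast hd0
  -- the inner endpoint is in the rigid ball
  have hin : (δ : ℂ) * hexCenter (x + Pi.single 0 d, (0 : Fin 2)) ∈ ball a₀ ρ := by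
    apply hball
    have hedge : s((x + Pi.single 0 d - Pi.single 1 1, (1 : Fin 2)), (x + Pi.single 0 d, 0)) ∈
        hexGraph.edgeSet := (SimpleGraph.mem_edgeSet hexGraph).2 (adj_floorEdge _)
    have h1 := dist_hexCenter_hexMidpoint_le hedge (Sym2.mem_mk_right _ _)
    have h2 : dist (hexMidpoint s((x + Pi.single 0 d - Pi.single 1 1, (1 : Fin 2)), (x + Pi.single 0 d, 0)))
        (hexMidpoint s((x - Pi.single 1 1, 1), (x, 0))) ≤ R := by
      rw [dist_comm, dist_hexMidpoint_offset, abs_of_pos hdpos]; exact hdR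
    have h4 := dist_triangle (hexCenter (x + Pi.single 0 d, (0 : Fin 2)))
      (hexMidpoint s((x + Pi.single 0 d - Pi.single 1 1, (1 : Fin 2)), (x + Pi.single 0 d, 0)))
      (hexMidpoint s((x - Pi.single 1 1, 1), (x, 0)))
    linarith
  have hrow : m ≤ (x + Pi.single 0 d : Site 2) 1 := by rw [offsetCell_apply_one, hx1]
  have hy0 : (x + Pi.single 0 d, (0 : Fin 2)) ∈ Λ := (hrows _ hin).2 hrow
  have hy1 : (x + Pi.single 0 d : Site 2) 1 = x 1 := offsetCell_apply_one x d
  have hyx : (x + Pi.single 0 d : Site 2) ≠ x := offsetCell_ne x hd0.ne'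
  have hne : s((x - Pi.single 1 1, (1 : Fin 2)), (x, 0)) ≠
      s((x + Pi.single 0 d - Pi.single 1 1, 1), (x + Pi.single 0 d, 0)) := by
    intro h
    have hmem : (x + Pi.single 0 d, (0 : Fin 2)) ∈ s((x - Pi.single 1 1, (1 : Fin 2)), (x, 0)) := by
      rw [h]; exact Sym2.mem_mk_right _ _
    rcases Sym2.mem_iff.1 hmem with h' | h'
    · exact (show (0 : Fin 2) ≠ 1 by decide) (congrArg Prod.snd h')
    · exact hyx (congrArg Prod.fst h')
  have hyd : (x + Pi.single 0 d - Pi.single 1 1, (1 : Fin 2)) ∉ Λ := floorEdge_down_not_mem hrowsΛ hy1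
  exact ⟨hy0, floorEdge_mem_hexDomainBoundary hrowsΛ hy1 hy0,
    nonempty_hexMidEdgeSAW_of_preconnected hconn (adj_floorEdge x) hxd hx0 hyd hy0 hne⟩

/-- Cardinality of an integer window as a real number: `#(Icc a b) ≤ b - a + 1` when `a ≤ b + 1`. [folklore] -/
theorem card_Icc_le_real {p q : ℤ} (h : p ≤ q + 1) : ((Finset.Icc p q).card : ℝ) ≤ (q : ℝ) - p + 1 := by
  rw [Int.card_Icc]
  have h0 : 0 ≤ q + 1 - p := by omega
  have : ((q + 1 - p).toNat : ℤ) = q + 1 - p := Int.toNat_of_nonneg h0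
  have hcast : (((q + 1 - p).toNat : ℕ) : ℝ) = ((q + 1 - p : ℤ) : ℝ) := by exact_mod_cast this
  rw [hcast]; push_cast; linarith

/-! ### The window inequality from the arch aspect bound -/

/-- **THE WINDOW INEQUALITY FROM THE ARCH ASPECT BOUND** (the floor-ratio limit supplies the window gain).
See the module docstring.  Hypotheses: the admissibility clause of the mechanism stub, the root/target limits, a
radius `0 < ρ₁ ≤ ρ`, a profile `G` continuous on `(0, ρ₁)` with `G(t) ≥ κ t^{-5/4}` attained along every admissible
floor family (`hG`), and the body of the arch aspect bound for `(θa, θb, C)`.  Conclusion: for every `η > 0` and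
`0 < θ₀ ≤ θa` some `θ₁ ∈ (0, θ₀)` such that eventually along `δ → 0⁺` the window inequality holds at the root
cell. [cite: LawlerSchrammWerner2004SAW, §3.4 ("SAW satisfies restriction") and Prop. 2] -/
theorem windowIneq_of_aspectBound (D D' : DobrushinDomain) (ρ : ℝ) (Λ Λ' : ℝ → Finset HexVertex)
    (m : ℝ → ℤ) (a b : ℝ → Sym2 HexVertex) (hρ : 0 < ρ)
    (hev : ∀ᶠ δ : ℝ in 𝓝[>] 0,
      Λ' δ ⊆ Λ δ ∧ hexDomainSimplyConnected (Λ δ) ∧ hexDomainSimplyConnected (Λ' δ) ∧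
      (hexGraph.induce (↑(Λ δ) : Set HexVertex)).Preconnected ∧
      (hexGraph.induce (↑(Λ' δ) : Set HexVertex)).Preconnected ∧
      a δ ∈ hexDomainBoundary (Λ δ) ∧ b δ ∈ hexDomainBoundary (Λ δ) ∧
      a δ ∈ hexDomainBoundary (Λ' δ) ∧ b δ ∈ hexDomainBoundary (Λ' δ) ∧
      Nonempty (HexMidEdgeSAW (Λ' δ) (a δ) (b δ)) ∧
      (∀ v ∈ Λ δ, (δ : ℂ) * hexCenter v ∈ D.carrier ∧ m δ ≤ v.1 1) ∧
      (∀ v ∈ Λ' δ, (δ : ℂ) * hexCenter v ∈ D'.carrier) ∧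
      (∀ v : HexVertex, (δ : ℂ) * hexCenter v ∈ ball (D.pt 0) ρ ∪ ball (D.pt 1) ρ →
        ((v ∈ Λ δ ↔ m δ ≤ v.1 1) ∧ (v ∈ Λ' δ ↔ m δ ≤ v.1 1))))
    (ha : Tendsto (fun δ : ℝ => (δ : ℂ) * hexMidpoint (a δ)) (𝓝[>] 0) (𝓝 (D.pt 0)))
    (hb : Tendsto (fun δ : ℝ => (δ : ℂ) * hexMidpoint (b δ)) (𝓝[>] 0) (𝓝 (D.pt 1)))
    {ρ₁ : ℝ} (hρ₁ : 0 < ρ₁) (hρ₁ρ : ρ₁ ≤ ρ) {G : ℝ → ℝ} {κ : ℝ} (hκ : 0 < κ)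
    (hGc : ContinuousOn G (Set.Ioo 0 ρ₁)) (hGκ : ∀ t : ℝ, 0 < t → t < ρ₁ → κ * t ^ (-(5 / 4 : ℝ)) ≤ G t)
    (hG : ∀ (e : ℝ → Sym2 HexVertex) (t : ℝ), 0 < t → t ≤ ρ₁ / 4 →
      Tendsto (fun δ : ℝ => (δ : ℂ) * hexMidpoint (e δ)) (𝓝[>] 0) (𝓝 (D.pt 0 + t)) →
      (∀ᶠ δ : ℝ in 𝓝[>] 0, e δ ∈ hexDomainBoundary (Λ δ) ∧ Nonempty (HexMidEdgeSAW (Λ δ) (a δ) (e δ)) ∧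
        ∃ x yy : Site 2, a δ = s((x - Pi.single 1 1, 1), (x, 0)) ∧
          e δ = s((yy - Pi.single 1 1, 1), (yy, 0)) ∧ yy 1 = x 1 ∧ yy ≠ x) →
      Tendsto (fun δ : ℝ =>
        (∑ γ : HexMidEdgeSAW (Λ δ) (a δ) (e δ), hexCriticalFugacity ^ γ.length) /
          (∑ γ : HexMidEdgeSAW (Λ δ) (a δ) (b δ), hexCriticalFugacity ^ γ.length)) (𝓝[>] 0) (𝓝 (G t)))
    {θa θb C : ℝ} (hθa : 0 < θa) (hθab : θa < θb) (hθb4 : θb ≤ 1 / 4) (hC : 0 < C)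
    (hA : ∀ θ₁ : ℝ, 0 < θ₁ → θ₁ < θa → ∃ R₀ : ℝ, 0 < R₀ ∧ ∀ R : ℝ, R₀ ≤ R →
      ∀ (x : Site 2) (L B : Finset HexVertex) (S S' : Finset ℤ),
        (∀ v ∈ L, x 1 ≤ v.1 1) →
        (∀ v : HexVertex, v ∈ B ↔ (x 1 ≤ v.1 1 ∧
          dist (hexCenter v) (hexMidpoint s((x - Pi.single 1 1, 1), (x, 0))) ≤ R)) →
        (∀ d : ℤ, d ∈ S ↔ (θ₁ * R ≤ (d : ℝ) ∧ (d : ℝ) ≤ θa * R)) →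
        (∀ d : ℤ, d ∈ S' ↔ (θa * R ≤ (d : ℝ) ∧ (d : ℝ) ≤ θb * R)) →
        ∑ d ∈ S, (∑ γ : HexMidEdgeSAW L s((x - Pi.single 1 1, 1), (x, 0))
            s((x + Pi.single 0 d - Pi.single 1 1, 1), (x + Pi.single 0 d, 0)),
          if ∃ v ∈ γ.verts, R ≤ dist (hexCenter v) (hexMidpoint s((x - Pi.single 1 1, 1), (x, 0)))
          then hexCriticalFugacity ^ γ.length else 0) ≤
        C * ∑ d ∈ S', ∑ γ : HexMidEdgeSAW B s((x - Pi.single 1 1, 1), (x, 0))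
            s((x + Pi.single 0 d - Pi.single 1 1, 1), (x + Pi.single 0 d, 0)), hexCriticalFugacity ^ γ.length) :
    ∀ η : ℝ, 0 < η → ∀ θ₀ : ℝ, 0 < θ₀ → θ₀ ≤ θa → ∃ θ₁ : ℝ, 0 < θ₁ ∧ θ₁ < θ₀ ∧
      ∀ᶠ δ : ℝ in 𝓝[>] 0, ∀ x : Site 2, x 1 = m δ → a δ = s((x - Pi.single 1 1, 1), (x, 0)) →
        ∑ d ∈ Finset.Icc ⌈θ₁ * (ρ₁ / 2 / δ)⌉ ⌊θ₀ * (ρ₁ / 2 / δ)⌋,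
            (∑ γ : HexMidEdgeSAW (Λ δ) s((x - Pi.single 1 1, 1), (x, 0))
              s((x + Pi.single 0 d - Pi.single 1 1, 1), (x + Pi.single 0 d, 0)),
            if ∃ v ∈ γ.verts, ρ₁ / 2 / δ ≤ dist (hexCenter v) (hexMidpoint s((x - Pi.single 1 1, 1), (x, 0)))
            then hexCriticalFugacity ^ γ.length else 0) ≤
          η * ∑ d ∈ Finset.Icc ⌈θ₁ * (ρ₁ / 2 / δ)⌉ ⌊θ₀ * (ρ₁ / 2 / δ)⌋,
            ∑ γ : HexMidEdgeSAW (Λ δ) s((x - Pi.single 1 1, 1), (x, 0))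
              s((x + Pi.single 0 d - Pi.single 1 1, 1), (x + Pi.single 0 d, 0)),
            hexCriticalFugacity ^ γ.length := by
  intro η hη θ₀ hθ₀ hθ₀a
  have hx0 : 0 < hexCriticalFugacity := hexCriticalFugacity_pos_lt_one.1
  set a₀ : ℂ := D.pt 0 with ha₀
  set ρ₂ : ℝ := ρ₁ / 2 with hρ₂
  have hρ₂pos : 0 < ρ₂ := by positivity
  have hρ₂ρ : ρ₂ ≤ ρ / 2 := by rw [hρ₂]; linarith
  -- (0) a bound of the profile on the reference window `[θa ρ₂, θb ρ₂]`
  have hθb : 0 < θb := hθa.trans hθab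
  have hu : 0 < θa * ρ₂ := mul_pos hθa hρ₂pos
  have hv4 : θb * ρ₂ < ρ₁ / 4 := by rw [hρ₂]; nlinarith
  have hvρ₁ : θb * ρ₂ < ρ₁ := by linarith
  obtain ⟨Gm, hGm⟩ : ∃ Gm : ℝ, ∀ t ∈ Icc (θa * ρ₂) (θb * ρ₂), G t ≤ Gm := by
    have hK : IsCompact (Icc (θa * ρ₂) (θb * ρ₂)) := isCompact_Icc
    have hsub : Icc (θa * ρ₂) (θb * ρ₂) ⊆ Ioo 0 ρ₁ := fun t ht => ⟨lt_of_lt_of_le hu ht.1, lt_of_le_of_lt ht.2 hvρ₁⟩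
    obtain ⟨Gm, hGm⟩ := (hK.bddAbove_image (hGc.mono hsub))
    exact ⟨Gm, fun t ht => hGm ⟨t, ht, rfl⟩⟩
  set Gm' : ℝ := max Gm 0 with hGm'
  have hGm'0 : 0 ≤ Gm' := le_max_right _ _
  -- (1) the constants
  set M₁ : ℝ := θb * ρ₂ * (Gm' + 2) with hM₁
  have hM₁pos : 0 < M₁ := by positivity
  set M : ℝ := C * M₁ / η + 1 with hM
  have hMpos : 0 < M := by positivity
  have hκ2 : 0 < κ / 2 := by positivity
  obtain ⟨θ₁, hθ₁, hθ₁2, hblock⟩ := stub_windowBlockSumGe (κ / 2) ρ₂ θ₀ M hκ2 hρ₂pos hθ₀ hMpos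
  have hθ₁₀ : θ₁ < θ₀ := by linarith
  have hθ₁a : θ₁ < θa := lt_of_lt_of_le hθ₁₀ hθ₀a
  obtain ⟨R₀, hR₀, hAR⟩ := hA θ₁ hθ₁ hθ₁a
  set ε₁ : ℝ := κ / 2 * (2 * θ₁ * ρ₂) ^ (-(5 / 4 : ℝ)) with hε₁
  have hε₁pos : 0 < ε₁ := mul_pos hκ2 (Real.rpow_pos_of_pos (by positivity) _)
  refine ⟨θ₁, hθ₁, hθ₁₀, ?_⟩
  -- (2) eventual facts
  have hθ₀ρ₂ : θ₀ * ρ₂ < ρ₁ / 4 := by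
    have : θ₀ ≤ 1 / 4 := hθ₀a.trans (hθab.le.trans hθb4)
    rw [hρ₂]; nlinarith
  have eU := ratio_uniform_window D D' ρ Λ Λ' m a b hρ hev ha hb hρ₁ρ hGc hG hu
    (mul_le_mul_of_nonneg_right hθab.le hρ₂pos.le) hv4 one_pos
  have eL := ratio_uniform_window D D' ρ Λ Λ' m a b hρ hev ha hb hρ₁ρ hGc hG (mul_pos hθ₁ hρ₂pos)
    (mul_le_mul_of_nonneg_right hθ₁₀.le hρ₂pos.le) hθ₀ρ₂ hε₁pos
  have hδρ : ∀ᶠ δ : ℝ in 𝓝[>] 0, δ < ρ := mem_nhdsWithin_of_mem_nhds (Iio_mem_nhds hρ)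
  have e1 : ∀ᶠ δ : ℝ in 𝓝[>] 0, dist ((δ : ℂ) * hexMidpoint (a δ)) a₀ < ρ₂ / 2 :=
    Metric.tendsto_nhds.1 ha _ (by positivity)
  have e2 : ∀ᶠ δ : ℝ in 𝓝[>] 0, δ ≤ ρ₂ / R₀ := mem_nhdsWithin_of_mem_nhds (Iic_mem_nhds (by positivity))
  have e3 : ∀ᶠ δ : ℝ in 𝓝[>] 0, δ ≤ θa * ρ₂ := mem_nhdsWithin_of_mem_nhds (Iic_mem_nhds hu)
  have e4 : ∀ᶠ δ : ℝ in 𝓝[>] 0, δ < ρ₂ / 2 := mem_nhdsWithin_of_mem_nhds (Iio_mem_nhds (by positivity))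
  filter_upwards [hev, eU, eL, hblock, hδρ, e1, e2, e3, e4, self_mem_nhdsWithin] with δ hevδ hUδ hLδ hblockδ
    hδρ e1 e2 e3 e4 hδ
  obtain ⟨hsubΛ, -, -, hconn, -, haΛ, -, -, -, hne', hΛD, -, hrows⟩ := hevδ
  have hδ0 : (0 : ℝ) < δ := hδ
  intro x hx1 hax
  -- the root cell
  obtain ⟨x', -, hax', hx0Λ, -, hxdΛ, -⟩ := floorEdge_data (Λ' := Λ' δ) hδ0 hδρ haΛ
    (lt_of_lt_of_le e1 (by linarith)) fun v hv => hrows v (Or.inl hv)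
  have hxx : x' = x := floorEdge_inj (hax'.symm.trans hax)
  subst hxx
  have hrowsΛ : ∀ v ∈ Λ δ, x' 1 ≤ v.1 1 := fun v hv => hx1 ▸ (hΛD v hv).2
  -- the lattice radius
  set R : ℝ := ρ₂ / δ with hRdef
  have hRpos : 0 < R := div_pos hρ₂pos hδ0
  have hRδ : δ * R = ρ₂ := by rw [hRdef]; field_simp
  have hR₀R : R₀ ≤ R := by
    rw [hRdef, le_div_iff₀ hδ0]
    calc R₀ * δ ≤ R₀ * (ρ₂ / R₀) := mul_le_mul_of_nonneg_left e2 hR₀.le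
      _ = ρ₂ := by field_simp
  have hR1 : 1 ≤ θa * R := by
    rw [hRdef, mul_div_assoc', le_div_iff₀ hδ0, one_mul]; exact e3
  -- the rigid ball
  have hball : ∀ v : HexVertex, dist (hexCenter v) (hexMidpoint s((x' - Pi.single 1 1, 1), (x', 0))) ≤ R + 1 / 2 →
      (δ : ℂ) * hexCenter v ∈ ball a₀ ρ := by
    intro v hv
    rw [← hax'] at hv
    rw [mem_ball]
    have h := dist_mesh_le hδ0.le hv e1.le
    have h' : δ * (R + 1 / 2) = ρ₂ + δ / 2 := by rw [mul_add, hRδ]; ring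
    calc dist ((δ : ℂ) * hexCenter v) a₀ ≤ δ * (R + 1 / 2) + ρ₂ / 2 := h
      _ = ρ₂ + δ / 2 + ρ₂ / 2 := by rw [h']
      _ < ρ := by linarith
  have hrowsB : ∀ v : HexVertex, (δ : ℂ) * hexCenter v ∈ ball a₀ ρ → (v ∈ Λ δ ↔ m δ ≤ v.1 1) :=
    fun v hv => (hrows v (Or.inl hv)).1
  -- admissibility of every point `0 < d ≤ R`
  have hadm : ∀ d : ℤ, 0 < d → (d : ℝ) ≤ R →
      (x' + Pi.single 0 d, (0 : Fin 2)) ∈ Λ δ ∧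
      s((x' + Pi.single 0 d - Pi.single 1 1, 1), (x' + Pi.single 0 d, 0)) ∈ hexDomainBoundary (Λ δ) ∧
      Nonempty (HexMidEdgeSAW (Λ δ) s((x' - Pi.single 1 1, 1), (x', 0))
        s((x' + Pi.single 0 d - Pi.single 1 1, 1), (x' + Pi.single 0 d, 0))) := fun d hd0 hdR =>
    windowPoint_admissible hrowsB hball hx1 hrowsΛ hx0Λ hxdΛ hconn hd0 hdR
  -- the half-box and the three windows
  set B : Finset HexVertex := (Λ δ).filter fun v =>
    dist (hexCenter v) (hexMidpoint s((x' - Pi.single 1 1, 1), (x', 0))) ≤ R with hB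
  have hBsub : B ⊆ Λ δ := Finset.filter_subset _ _
  have hBiff : ∀ v : HexVertex, v ∈ B ↔ (x' 1 ≤ v.1 1 ∧
      dist (hexCenter v) (hexMidpoint s((x' - Pi.single 1 1, 1), (x', 0))) ≤ R) := by
    intro v
    rw [hB, Finset.mem_filter]
    constructor
    · rintro ⟨hvΛ, hvd⟩; exact ⟨hrowsΛ v hvΛ, hvd⟩
    · rintro ⟨hvrow, hvd⟩
      exact ⟨(hrowsB v (hball v (by linarith))).2 (hx1 ▸ hvrow), hvd⟩
  set S₀ : Finset ℤ := Finset.Icc ⌈θ₁ * R⌉ ⌊θ₀ * R⌋ with hS₀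
  set Sa : Finset ℤ := Finset.Icc ⌈θ₁ * R⌉ ⌊θa * R⌋ with hSa
  set S' : Finset ℤ := Finset.Icc ⌈θa * R⌉ ⌊θb * R⌋ with hS'
  have hS₀Sa : S₀ ⊆ Sa := Finset.Icc_subset_Icc le_rfl (Int.floor_mono (mul_le_mul_of_nonneg_right hθ₀a hRpos.le))
  -- the arch aspect bound at scale `R`
  have hAAB := hAR R hR₀R x' (Λ δ) B Sa S' hrowsΛ hBiff (mem_window_iff θ₁ θa R) (mem_window_iff θa θb R)
  -- name the masses
  set Z : ℤ → ℝ := fun d => ∑ γ : HexMidEdgeSAW (Λ δ) s((x' - Pi.single 1 1, 1), (x', 0))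
      s((x' + Pi.single 0 d - Pi.single 1 1, 1), (x' + Pi.single 0 d, 0)), hexCriticalFugacity ^ γ.length with hZ
  set F : ℤ → ℝ := fun d => ∑ γ : HexMidEdgeSAW (Λ δ) s((x' - Pi.single 1 1, 1), (x', 0))
      s((x' + Pi.single 0 d - Pi.single 1 1, 1), (x' + Pi.single 0 d, 0)),
        if ∃ v ∈ γ.verts, R ≤ dist (hexCenter v) (hexMidpoint s((x' - Pi.single 1 1, 1), (x', 0)))
        then hexCriticalFugacity ^ γ.length else 0 with hF
  set Zb : ℝ := ∑ γ : HexMidEdgeSAW (Λ δ) (a δ) (b δ), hexCriticalFugacity ^ γ.length with hZb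
  have hZb : 0 < Zb := lt_of_lt_of_le (sum_pow_length_pos hne') (archMass_mono hsubΛ _ _)
  clear_value Zb
  have hFnn : ∀ d, 0 ≤ F d := fun d => Finset.sum_nonneg fun γ _ => by
    split_ifs
    · exact pow_nonneg hx0.le _
    · exact le_rfl
  have hZnn : ∀ d, 0 ≤ Z d := fun d => Finset.sum_nonneg fun _ _ => pow_nonneg hx0.le _
  -- (3) upper bound of the reference mass: `Σ_{S'} Z ≤ (M₁/δ) · Zb`
  have hS'card : (S'.card : ℝ) ≤ θb * R := by
    have h1 : (⌈θa * R⌉ : ℝ) < θa * R + 1 := Int.ceil_lt_add_one _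
    have h2 : (⌊θb * R⌋ : ℝ) ≤ θb * R := Int.floor_le _
    have h3 : θa * R ≤ (⌈θa * R⌉ : ℝ) := Int.le_ceil _
    have h4 : (θb * R : ℝ) < ⌊θb * R⌋ + 1 := Int.lt_floor_add_one _
    have hab : θa * R ≤ θb * R := mul_le_mul_of_nonneg_right hθab.le hRpos.le
    have hpq : ⌈θa * R⌉ ≤ ⌊θb * R⌋ + 1 := Int.ceil_le.2 (by push_cast; linarith)
    calc (S'.card : ℝ) ≤ (⌊θb * R⌋ : ℝ) - ⌈θa * R⌉ + 1 := card_Icc_le_real hpq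
      _ ≤ θb * R := by linarith
  have hrefpt : ∀ d ∈ S', Z d ≤ (Gm' + 2) * Zb := by
    intro d hd
    obtain ⟨hd1, hd2⟩ := (mem_window_iff θa θb R d).1 hd
    have hd0 : 0 < d := by exact_mod_cast lt_of_lt_of_le (by positivity : (0 : ℝ) < θa * R) hd1
    have hθb1 : θb ≤ 1 := hθb4.trans (by norm_num)
    have hdR : (d : ℝ) ≤ R := hd2.trans (mul_le_of_le_one_left hRpos.le hθb1)
    obtain ⟨-, hbd, hne⟩ := hadm d hd0 hdR
    have hud : θa * ρ₂ ≤ δ * d := by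
      have := mul_le_mul_of_nonneg_left hd1 hδ0.le
      rwa [← mul_assoc, mul_comm δ θa, mul_assoc, hRδ] at this
    have hdv : δ * d ≤ θb * ρ₂ := by
      have := mul_le_mul_of_nonneg_left hd2 hδ0.le
      rwa [← mul_assoc, mul_comm δ θb, mul_assoc, hRδ] at this
    have hU := hUδ x' d hax' hud hdv hbd (hax' ▸ hne)
    rw [hax'] at hU
    have hU' := (abs_le.1 hU).2
    have hGd : G (δ * d) ≤ Gm' := (hGm _ ⟨hud, hdv⟩).trans (le_max_left _ _)
    have hratio : (∑ γ : HexMidEdgeSAW (Λ δ) s((x' - Pi.single 1 1, 1), (x', 0))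
        s((x' + Pi.single 0 d - Pi.single 1 1, 1), (x' + Pi.single 0 d, 0)), hexCriticalFugacity ^ γ.length) / Zb ≤
        Gm' + 2 := by linarith
    have hratio' := (div_le_iff₀ hZb).1 hratio
    simpa only [hZ] using hratio'
  have hupper : ∑ d ∈ S', Z d ≤ M₁ / δ * Zb := by
    calc ∑ d ∈ S', Z d ≤ ∑ _d ∈ S', (Gm' + 2) * Zb := Finset.sum_le_sum hrefpt
      _ = S'.card * ((Gm' + 2) * Zb) := by rw [Finset.sum_const, nsmul_eq_mul]
      _ ≤ (θb * R) * ((Gm' + 2) * Zb) := mul_le_mul_of_nonneg_right hS'card (by positivity)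
      _ = M₁ / δ * Zb := by rw [hM₁, hRdef]; ring
  -- (4) lower bound of the window mass: `Σ_{S₀} Z ≥ (M/δ) · Zb`
  have hlower : M / δ * Zb ≤ ∑ d ∈ S₀, Z d := by
    have h2R : 2 * θ₁ * R ≤ θ₀ * R := mul_le_mul_of_nonneg_right hθ₁2.le hRpos.le
    have hS₀mem : ∀ d : ℤ, (θ₁ * R ≤ (d : ℝ) ∧ (d : ℝ) ≤ 2 * θ₁ * R) → d ∈ S₀ :=
      fun d hd => (mem_window_iff θ₁ θ₀ R d).2 ⟨hd.1, hd.2.trans h2R⟩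
    set g : ℤ → ℝ := fun d => Z d / Zb with hg_def
    have hgnn : ∀ d ∈ S₀, 0 ≤ g d := fun d _ => div_nonneg (hZnn d) hZb.le
    have hgblock : ∀ d ∈ S₀, θ₁ * R ≤ (d : ℝ) → (d : ℝ) ≤ 2 * θ₁ * R →
        κ / 2 * (δ * d) ^ (-(5 / 4 : ℝ)) ≤ g d := ?_
    · have hg := hblockδ S₀ hS₀mem g hgnn hgblock
      have : ∑ d ∈ S₀, g d = (∑ d ∈ S₀, Z d) / Zb := by rw [hg_def, Finset.sum_div]
      rw [this, le_div_iff₀ hZb] at hg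
      exact hg
    intro d hd hd1 hd2
    obtain ⟨hd1', hd2'⟩ := (mem_window_iff θ₁ θ₀ R d).1 hd
    have hd0 : 0 < d := by exact_mod_cast lt_of_lt_of_le (by positivity : (0 : ℝ) < θ₁ * R) hd1'
    have hθ₀1 : θ₀ ≤ 1 := (hθ₀a.trans (hθab.le.trans hθb4)).trans (by norm_num)
    have hdR : (d : ℝ) ≤ R := hd2'.trans (mul_le_of_le_one_left hRpos.le hθ₀1)
    obtain ⟨-, hbd, hne⟩ := hadm d hd0 hdR
    have hud : θ₁ * ρ₂ ≤ δ * d := by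
      have := mul_le_mul_of_nonneg_left hd1' hδ0.le
      rwa [← mul_assoc, mul_comm δ θ₁, mul_assoc, hRδ] at this
    have hdv : δ * d ≤ θ₀ * ρ₂ := by
      have := mul_le_mul_of_nonneg_left hd2' hδ0.le
      rwa [← mul_assoc, mul_comm δ θ₀, mul_assoc, hRδ] at this
    have hdv2 : δ * d ≤ 2 * θ₁ * ρ₂ := by
      have := mul_le_mul_of_nonneg_left hd2 hδ0.le
      rwa [show δ * (2 * θ₁ * R) = 2 * θ₁ * (δ * R) by ring, hRδ] at this
    have hδd : 0 < δ * d := lt_of_lt_of_le (mul_pos hθ₁ hρ₂pos) hud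
    have hL := hLδ x' d hax' hud hdv hbd (hax' ▸ hne)
    have hL' := (abs_le.1 hL).1
    have hGd : κ * (δ * d) ^ (-(5 / 4 : ℝ)) ≤ G (δ * d) := hGκ _ hδd (by linarith)
    have hpow : (2 * θ₁ * ρ₂) ^ (-(5 / 4 : ℝ)) ≤ (δ * d) ^ (-(5 / 4 : ℝ)) :=
      Real.rpow_le_rpow_of_nonpos hδd hdv2 (by norm_num)
    have hε₁le : ε₁ ≤ κ / 2 * (δ * d) ^ (-(5 / 4 : ℝ)) := mul_le_mul_of_nonneg_left hpow hκ2.le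
    rw [hax'] at hL'
    show κ / 2 * (δ * d) ^ (-(5 / 4 : ℝ)) ≤ (∑ γ : HexMidEdgeSAW (Λ δ) s((x' - Pi.single 1 1, 1), (x', 0))
        s((x' + Pi.single 0 d - Pi.single 1 1, 1), (x' + Pi.single 0 d, 0)), hexCriticalFugacity ^ γ.length) / Zb
    linarith
  -- (5) the chain
  have hkey : C * M₁ ≤ η * M := by
    rw [hM, mul_add, mul_div_cancel₀ _ hη.ne']; nlinarith
  calc ∑ d ∈ S₀, F d ≤ ∑ d ∈ Sa, F d := Finset.sum_le_sum_of_subset_of_nonneg hS₀Sa fun d _ _ => hFnn d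
    _ ≤ C * ∑ d ∈ S', ∑ γ : HexMidEdgeSAW B s((x' - Pi.single 1 1, 1), (x', 0))
          s((x' + Pi.single 0 d - Pi.single 1 1, 1), (x' + Pi.single 0 d, 0)), hexCriticalFugacity ^ γ.length := hAAB
    _ ≤ C * ∑ d ∈ S', Z d := by
        refine mul_le_mul_of_nonneg_left (Finset.sum_le_sum fun d _ => ?_) hC.le
        exact archMass_mono hBsub _ _
    _ ≤ C * (M₁ / δ * Zb) := mul_le_mul_of_nonneg_left hupper hC.le
    _ = (C * M₁) / δ * Zb := by rw [← mul_assoc, ← mul_div_assoc]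
    _ ≤ (η * M) / δ * Zb := by
        refine mul_le_mul_of_nonneg_right ?_ hZb.le
        exact div_le_div_of_nonneg_right hkey hδ0.le
    _ = η * (M / δ * Zb) := by rw [mul_div_assoc, mul_assoc]
    _ ≤ η * ∑ d ∈ S₀, Z d := mul_le_mul_of_nonneg_left hlower hη.le

/-! ### Registered form -/

/-- **Registered sub-goal `stub_cardIccLeReal`** (crux item stmt-CriticalPhenomena-0808, line `root-locality-replaces-loewner`,
lead continuation c6): the real cardinality bound of an integer window (`card_Icc_le_real`). [folklore] -/
theorem stub_cardIccLeReal : ∀ (p q : ℤ), p ≤ q + 1 → ((Finset.Icc p q).card : ℝ) ≤ (q : ℝ) - p + 1 :=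
  fun _ _ h => card_Icc_le_real h

end Summit.CriticalPhenomena.SAWScalingLimit.Theorems.HexConjecture.RootLocality

end
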